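import Summits.HodgeConjecture.HodgeConjecture.Theorems.MarkmanPartnerTransportPicardThreeK3SquaresRMTypeOpenSingleEigenvalue
import Summits.HodgeConjecture.HodgeConjecture.Theorems.MarkmanPartnerTransportPicardThreeK3SquaresNSAbsorption
import HarnessLib

/-!
# Route MarkmanPartnerTransport · crux `PicardThreeK3Squares` (stmt-HodgeConjecture-19652) —
# (T⁗) RM-TYPE DESCENT FROM AN OPEN SET TO EVERY SUB-TYPE: the Noether–Lefschetz-special surfaces of a
# real-multiplication Hodge locus on which the type is cycle-induced on an open period set

Cell hodge-nonav, crux #4 (HC⁴(S ⊗ S), ρ(S) ≥ 3; open core: real multiplication), programme «RATIONAL ORBIT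
DENSITY» continued (prover seat hodge-nonav-19652-p1 gen 20; `--supports stmt-HodgeConjecture-19652`,
helper). CONDITIONAL on the named fact `Buskin2019_hodgeIsometry_algebraic` and a DISPLAYED open-set input
only; credits nothing; nothing here says HC is proved.

THE POINT. The descent theorems (T′)/(T″)/(T‴) of gen 10 (`…RMTypeOpenDescent`, `…RMTypeOpenExists`,
`…RMTypeOpenSingleEigenvalue`) serve the K3 surfaces `S` whose generator `t` is conjugate to the model
`θ_ℂ` on ALL of `H²(S)` (`σ η t = θ_ℂ σ η`): then `θ` kills `σ η N¹(S)`, the period `σ x` is a `θ`-GENERIC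
point of the Hodge locus `D_{θ,e}`, and `S` has the Picard number of the very general member (for the
maximal van Geemen–Schütt types: `ρ = 10`, `10`, `2`). The Hodge locus also carries NOETHER–LEFSCHETZ-
SPECIAL points: periods `y ∈ D_{θ,e}` orthogonal to rational vectors NOT killed by `θ` — K3 surfaces of
HIGHER Picard number whose transcendental lattice is a proper `θ`-stable sublattice of the model's, on
which the generator is conjugate to `θ` (van Geemen–Schütt §6.6: the `ρ = 12` sub-loci of the `√2`-family;
in general every `S` whose pair `(T(S)_ℚ, t)` embeds isometrically and equivariantly into the model
`(T_θ, θ)`, e.g. `ρ(S) = 13` with cubic RM by `ℚ(ζ₉ + ζ₉⁻¹)` inside the ζ₉ model, `ρ(S) = 7` or `12` with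
quintic RM by `ℚ(ζ₁₁ + ζ₁₁⁻¹)` inside the ζ₁₁ model — subject to a lattice-embedding condition). This file
proves that the SAME mechanism reaches them, with two changes: (1) the conjugation hypothesis is asked on
the TRANSCENDENTAL classes only (`σ η (t c) = θ_ℂ σ η c` for `c ⊥ N¹(S)`); (2) the displayed input must
provide the cycle at EVERY period of the open set, not only at the `θ`-generic ones (`CycleAll[θ, e, U]`
below; for an explicit maximal family this is what maximality + «cycle on every member» gives anyway —
the members over the open period image include the Noether–Lefschetz-special ones). The new step in the
proof: after orbit density and Buskin transport, the cycle-induced endomorphism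
`Θ = η⁻¹(gσ)⁻¹ θ_ℂ (gσ) η` of `H²(S)` agrees with `t` only on `T(S)`; but `Θ` is rational and maps `N¹(S)`
into `N¹(S)` (its values on divisor classes are rational of type `(1,1)`, because `θ_ℂ(gσx) = e·gσx` and
`θ` is self-adjoint — Lefschetz `(1,1)`), so `Θ − t` is Néron–Severi-supported and the tree's NS-ABSORPTION
(`NSAbsorption.exists_corr_of_add_neronSeveriSupported`, p710971) makes `t` itself cycle-induced. In the
Noether–Lefschetz language of the cell (memo NL-ASCENT, gen 18): the DOWNWARD step «HC⁴ for the very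
general member of an RM family ⇒ HC⁴ for its special members» is obtained here WITHOUT the moduli input
(I1′) (no universal family, no flat section, no closedness of algebraic loci), for the families whose
type is cycle-induced on an open period set.

* `exists_posKernel_of_openAll` — the `θ`-generic witness point of the input supplies a rational vector of
  positive square killed by `θ` (the Hodge-index input of orbit density).
* **`hodgeConjectureFor_square_of_openAll_of_transc` — (T⁗)**: `θ` self-adjoint with an eigenprojector
  certificate at the real eigenvalue `e ≠ 0`; the strong open input `OpenAll[θ, e]`; a marked projective
  K3 surface `(S, η, p, x)` with `t` rational, killing `N¹`, generating `End_Hdg T(S)`, `t(η⁻¹x) = e·η⁻¹x`;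
  a rational isometry `σ` with `σ η t = θ_ℂ σ η` ON `T(S)` ⟹ `HodgeConjectureFor 4 (S ⊗ S)`.
* Companion `…RMTypeOpenSubtypeByName`: the same BY NAME from the RM data (`P` separable with `P(0) ≠ 0`
  annihilating `t` on `T(S)`, the model identity `θ_ℂ·P(θ_ℂ) = 0`; eigenvalue and certificate derived),
  and the sub-type corollaries for the maximal van Geemen–Schütt types.

No definition, no sorry, no new named fact. References: van Geemen–Schütt, Forum Math. Sigma 13 (2025) e2, §2.1, §3.4, §4.8,
§6.6; Buskin, J. reine angew. Math. 755 (2019), Thm. 1.1, §6.2 Lemma 6.3; Varesco, Math. Z. 305 (2023)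
art. 69, §2; Voisin, *Hodge Theory II*, §5.3.4 (Noether–Lefschetz loci); Huybrechts, *Lectures on K3
Surfaces*, Ch. 3 §3.2, Ch. 6 Prop. 1.2/1.5; Fulton, *Intersection Theory*, §16.1 Prop. 16.1.1; O'Meara,
*Introduction to Quadratic Forms*, §42–§43B.
-/

set_option linter.dupNamespace false

noncomputable section

namespace Summit.HodgeConjecture.HodgeConjecture.Theorems.MarkmanPartnerTransport.RMTypeOrbit

open CategoryTheory MonoidalCategory Polynomial
open Literature.AlgebraicGeometry Literature.AlgebraicGeometry.Motives Literature.AlgebraicGeometry.HodgeTheory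
open Literature.AlgebraicGeometry.Surfaces Literature.LinearAlgebra.QuadraticForm
open Literature.AlgebraicTopology.SingularHomology
open Summit.HodgeConjecture.HodgeConjecture.Theorems.NikulinTwinTransport
open Summit.HodgeConjecture.HodgeConjecture.Theorems.NikulinTwinTransport.SquareGlueFree
open Summit.HodgeConjecture.HodgeConjecture.Theorems.MarkmanPartnerTransport.IsogenyInvariance
open Summit.HodgeConjecture.HodgeConjecture.Theorems.MarkmanPartnerTransport.RMTypeDescent

/-- `MarkedK3[S, η, p, x]`: VERBATIM the `let MarkedK3 := …` binder of the route declaration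
`PicardThreeK3Squares` (as in `…RMTypeDescent`). Local notation only. -/
local notation3 (prettyPrint := false) "MarkedK3[" S ", " η ", " p ", " x "]" =>
  (p ≠ 0 ∧ (IsIntegralClass p ∧
    (∀ q : complexBetti S (2 * 2), IsIntegralClass q → ∃ n : ℤ, q = n • p) ∧
    (∀ c : complexBetti S (2 * 1), IsIntegralClass c ↔ ∃ v : K3Index → ℤ, η c = fun i => (v i : ℂ)) ∧
    (∀ a b : complexBetti S (2 * 1),
      cupProduct (rfl : 2 * 1 + 2 * 1 = 2 * 2) a b = k3Form (η a) (η b) • p) ∧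
    IsOfHodgeType 2 S (2 * 1) 2 0 (LinearEquiv.symm η x) ∧
    (∀ τ : complexBetti S (2 * 1), IsOfHodgeType 2 S (2 * 1) 2 0 τ →
      ∃ t : ℂ, τ = t • LinearEquiv.symm η x)) ∧
    (k3Form x x = 0 ∧ 0 < (k3Form (star x) x).re ∧
      ∃ u : K3Index → ℤ, k3Form (fun i => (u i : ℂ)) x = 0 ∧ 0 < ∑ i, ∑ j, u i * k3Gram i j * u j))

variable {S : SchemeOver ℂ}

/-- `CycleAll[θ, e, U]`: the STRONG ∃-form open-set input — at EVERY period point of `D_{θ,e}` in `U`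
(`θ`-generic OR NOT) there is a marked projective K3 surface carrying an algebraic class inducing
`η'⁻¹ θ_ℂ η'`. (`CycleEx[θ, e, U]` of `…RMTypeOpenExists` is the same clause restricted to `θ`-generic
periods.) Local notation only. -/
local notation3 (prettyPrint := false) "CycleAll[" θ ", " e ", " U "]" =>
  (∀ y : K3Index → ℂ, y ∈ U → thetaC θ y = (e : ℂ) • y → k3Form y y = 0 → 0 < (k3Form (star y) y).re →
    ∃ (S' : SchemeOver ℂ) (hS' : IsK3Surface S') (η' : complexBetti S' (2 * 1) ≃ₗ[ℂ] (K3Index → ℂ))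
      (p' : complexBetti S' (2 * 2)), MarkedK3[S', η', p', y] ∧
      ∃ γ' ∈ algebraicClasses (S' ⊗ S') 2, ∀ z : complexBetti S' (2 * 1),
        (η'.symm.toLinearMap ∘ₗ (thetaC θ ∘ₗ η'.toLinearMap)) z =
          complexGysin complexOrientationFamily
            (IsSmoothProjective.tensor_holds hS'.isSmoothProjective hS'.isSmoothProjective)
            hS'.isSmoothProjective (SemiCartesianMonoidalCategory.fst S' S')
            (rfl : 2 * 1 + 2 * 2 + 2 * 2 = 2 * 1 + 2 * (2 + 2))
            (cupProduct (rfl : 2 * 1 + 2 * 2 = 2 * 1 + 2 * 2)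
              (complexBetti.map (SemiCartesianMonoidalCategory.snd S' S') (2 * 1) z) γ'))

/-- `OpenAll[θ, e]`: there is an open `U ⊂ Λ_ℂ` containing a `θ`-GENERIC period point of `D_{θ,e}` on
which `CycleAll[θ, e, U]` holds. Local notation only. -/
local notation3 (prettyPrint := false) "OpenAll[" θ ", " e "]" =>
  (∃ U : Set (K3Index → ℂ), IsOpen U ∧
    (∃ y₁ ∈ U, thetaC θ y₁ = (e : ℂ) • y₁ ∧ k3Form y₁ y₁ = 0 ∧ 0 < (k3Form (star y₁) y₁).re ∧
      ∀ v : K3Index → ℚ, k3Form (fun i => (v i : ℂ)) y₁ = 0 → Matrix.mulVec θ v = 0) ∧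
    CycleAll[θ, e, U])

/-- `Corr[hS ; γ, y] = fst_*(snd^* y ∪ γ)` on `H²(S(ℂ); ℂ)` at the complex orientation family. Local
notation only. -/
local notation3 (prettyPrint := false) "Corr[" hS " ; " γ ", " y "]" =>
  complexGysin complexOrientationFamily (IsSmoothProjective.tensor_holds hS hS) hS
    (SemiCartesianMonoidalCategory.fst _ _) (rfl : 2 * 1 + 2 * 2 + 2 * 2 = 2 * 1 + 2 * (2 + 2))
    (cupProduct (rfl : 2 * 1 + 2 * 2 = 2 * 1 + 2 * 2)
      (complexBetti.map (SemiCartesianMonoidalCategory.snd _ _) (2 * 1) y) γ)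

/-! ### A positive rational kernel vector from the generic witness -/

/-- The `θ`-generic witness point of `OpenAll[θ, e]` supplies a rational vector of positive square killed
by `θ`: the marked K3 surface with that period (clause `CycleAll`) carries an integral `u ⊥ y₁` with
`u² > 0`, and `θ u = 0` by `θ`-genericity. [cite: Huybrechts2016K3, Ch. 6 Rem. 3.3] -/
theorem exists_posKernel_of_openAll {θ : Matrix K3Index K3Index ℚ} {e : ℝ} (hOpen : OpenAll[θ, e]) :
    ∃ w : K3Index → ℚ, θ.mulVec w = 0 ∧ 0 < k3FormRat w w := by
  obtain ⟨U, -, ⟨y₁, hy₁U, hy₁, h₁₁, h₁p, hy₁gen⟩, hcyc⟩ := hOpen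
  obtain ⟨S₁, hS₁, η₁, p₁, hM₁, -⟩ := hcyc y₁ hy₁U hy₁ h₁₁ h₁p
  obtain ⟨u, hux, hupos⟩ := hM₁.2.2.2.2
  refine ⟨fun i => (u i : ℚ), hy₁gen _ ?_, ?_⟩
  · rw [← intCast_eq_ratCast_intCast]
    exact hux
  · rw [k3FormRat_intCast]
    exact_mod_cast hupos

/-! ### (T⁗) descent to sub-types -/

/-- **(T⁗) RM-TYPE DESCENT FROM AN OPEN SET TO EVERY SUB-TYPE.** Let `θ ∈ M₂₂(ℚ)` be
`k3Form`-self-adjoint with an eigenprojector certificate `π` at the real eigenvalue `e ≠ 0`, and assume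
the STRONG open input `OpenAll[θ, e]` (a cycle for `θ` at EVERY period of an open set `U` meeting
`D_{θ,e}` in a `θ`-generic point). Let `(S, η, p, x)` be a marked projective K3 surface with an
endomorphism `t` of `H²(S(ℂ); ℂ)` (rational, killing `N¹`, generating `End_Hdg T(S)`,
`t(η⁻¹x) = e·η⁻¹x`) and `σ` a rational isometry of `Λ_ℚ` conjugating `t` to `θ_ℂ` ON THE
TRANSCENDENTAL CLASSES ONLY: `σ η (t c) = θ_ℂ σ η c` for every `c` cup-orthogonal to `N¹(S)` — so
`σ η T(S)_ℚ` is a `θ`-stable sublattice of the model and `S` may be a Noether–Lefschetz-SPECIAL point of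
the Hodge locus of `θ` (higher Picard number; `θ` need not kill `σ η N¹(S)`). Then
`HodgeConjectureFor 4 (S ⊗ S)`. Proof: `σx ∈ D_{θ,e}` (the period is cup-transcendental); RATIONAL
ORBIT DENSITY (`exists_ratIsometry_commute_smul_mem_of_isOpen`, positive kernel vector from the generic
witness) gives `g ∈ G_θ(ℚ)`, `c ≠ 0` with `c·gσx ∈ U`; the input gives a marked `S'` there with an
algebraic `γ'` inducing `η'⁻¹θ_ℂη'`; Buskin for `η'⁻¹gση` and its inverse and composition
(`corrComp_K3_of_cup`) make `Θ := η⁻¹(gσ)⁻¹θ_ℂ(gσ)η` cycle-induced on `S`; `Θ = t` on `T(S)` and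
`Θ(N¹) ⊆ N¹` (rational, and of type `(1,1)` since `θ_ℂ(gσx) = e·gσx` and `θ` is self-adjoint;
Lefschetz `(1,1)`), so `Θ − t` is Néron–Severi-supported and NS-ABSORPTION
(`NSAbsorption.exists_corr_of_add_neronSeveriSupported`) makes `t` cycle-induced; Varesco's bookkeeping
(`SquareOfGenerator.squareOfGenerator`) concludes. CONDITIONAL on `Buskin2019_hodgeIsometry_algebraic`
and the displayed input only; credits nothing; HC is NOT proved here.
[cite: GeemenSchutt2023, §3.4, §4.8 and §6.6] [cite: Buskin2019, Thm. 1.1 and §6.2 Lemma 6.3]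
[cite: Varesco2023, §2 (p. 8)] [cite: VoisinHodgeII2003, §5.3.4] [cite: Fulton1998, §16.1 Prop. 16.1.1] -/
theorem hodgeConjectureFor_square_of_openAll_of_transc
    (hB : Buskin2019_hodgeIsometry_algebraic)
    {θ : Matrix K3Index K3Index ℚ}
    (hθsa : ∀ a b : K3Index → ℂ, k3Form (thetaC θ a) b = k3Form a (thetaC θ b))
    {e : ℝ} (he : e ≠ 0) {π : ℂ[X]} (hπe : π.eval (e : ℂ) = 1)
    (hπW : ∀ y : K3Index → ℂ,
      thetaC θ (aeval (thetaC θ) π (thetaC θ y)) = (e : ℂ) • aeval (thetaC θ) π (thetaC θ y))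
    (hOpen : OpenAll[θ, e])
    (hS : IsK3Surface S)
    (η : complexBetti S (2 * 1) ≃ₗ[ℂ] (K3Index → ℂ)) (p : complexBetti S (2 * 2)) (x : K3Index → ℂ)
    (hM : MarkedK3[S, η, p, x])
    (t : complexBetti S (2 * 1) →ₗ[ℂ] complexBetti S (2 * 1))
    (ht_rat : ∀ y, IsRationalClass y → IsRationalClass (t y))
    (ht_N : ∀ d ∈ algebraicClasses S 1, t d = 0)
    (hte : t (η.symm x) = (e : ℂ) • η.symm x)
    (hgen : TranscendentalEndomorphismsGeneratedBy S t)
    (σ : Module.End ℂ (K3Index → ℂ)) (hσ : ∀ a b, k3Form (σ a) (σ b) = k3Form a b)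
    (hσrat : ∀ v : K3Index → ℤ, ∃ w : K3Index → ℚ, σ (fun i => (v i : ℂ)) = fun i => (w i : ℂ))
    (hconj : ∀ c : complexBetti S (2 * 1),
      (∀ d ∈ algebraicClasses S 1, cupProduct (rfl : 2 * 1 + 2 * 1 = 2 * 2) c d = 0) →
        σ (η (t c)) = thetaC θ (σ (η c))) :
    HodgeConjectureFor 4 (S ⊗ S) := by
  classical
  have hHT : Huybrechts_K3_hodgeTypes_H2 := Huybrechts_K3_hodgeTypes_H2_holds
  have h4 : 2 * 1 + 2 * 1 = 2 * 2 := rfl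
  have hS2 : IsSmoothProjective 2 S := hS.isSmoothProjective
  obtain ⟨hp0, ⟨hpint, hpgen, hηint, hηcup, h20, hline⟩, hPer⟩ := hM
  have hxpos : 0 < (k3Form (star x) x).re := hPer.2.1
  have hx0 : η.symm x ≠ 0 := fun h0 =>
    ne_zero_of_star_self_re_pos hxpos (by simpa using congrArg η h0)
  -- algebraic classes are orthogonal to the period in the marking
  have hNx : ∀ d ∈ algebraicClasses S 1, k3Form (η d) x = 0 := by
    intro d hd
    obtain ⟨-, -, h3⟩ := hHT S hS (η.symm x) h20 hx0
    have h11 : IsOfHodgeType 2 S (2 * 1) 1 1 d :=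
      isOfHodgeType_of_mem_algebraicClasses_of_isSmoothProjective hS2 1 hd
    have hds := ((h3 d).1 h11).1
    rw [hηcup, η.apply_symm_apply, smul_eq_zero] at hds
    exact hds.resolve_right hp0
  -- (a) the period class is cup-transcendental
  have htransc : ∀ d ∈ algebraicClasses S 1, cupProduct h4 (η.symm x) d = 0 := by
    intro d hd
    rw [hηcup, η.apply_symm_apply, k3Form_comm, hNx d hd, zero_smul]
  -- (b) the period `σ x` is an `e`-eigenvector of `θ_ℂ`
  have heig : thetaC θ (σ x) = (e : ℂ) • σ x := by
    have h1 := hconj (η.symm x) htransc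
    rw [hte, map_smul, LinearEquiv.apply_symm_apply, map_smul] at h1
    exact h1.symm
  -- (c) a positive rational vector killed by `θ`, from the generic witness
  have hw : ∃ w : K3Index → ℚ, θ.mulVec w = 0 ∧ 0 < k3FormRat w w := exists_posKernel_of_openAll hOpen
  obtain ⟨U, hU, ⟨y₁, hy₁U, hy₁, h₁₁, h₁p, -⟩, hcyc⟩ := hOpen
  -- RATIONAL ORBIT DENSITY: move the period into `U` inside the isogeny class
  have hPσ := periodPt_ratIsometry σ hσ hσrat hPer
  obtain ⟨g, c, hc0, hgiso, hgrat, hgcomm, hgU⟩ := exists_ratIsometry_commute_smul_mem_of_isOpen hθsa he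
    hπe hπW hw heig hPσ.1 hPσ.2.1 hU hy₁U hy₁ h₁₁ h₁p
  set σ₁ : Module.End ℂ (K3Index → ℂ) := g ∘ₗ σ with hσ₁def
  have hσ₁ : ∀ a b, k3Form (σ₁ a) (σ₁ b) = k3Form a b := fun a b => by
    rw [hσ₁def, LinearMap.comp_apply, LinearMap.comp_apply, hgiso, hσ]
  have hσ₁rat : ∀ v : K3Index → ℤ, ∃ w : K3Index → ℚ, σ₁ (fun i => (v i : ℂ)) = fun i => (w i : ℂ) := by
    intro v
    obtain ⟨w₁, hw₁⟩ := hσrat v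
    obtain ⟨w₂, hw₂⟩ := ratEnd_ratCast g hgrat w₁
    exact ⟨w₂, by rw [hσ₁def, LinearMap.comp_apply, hw₁, hw₂]⟩
  have hconj₁ : ∀ a : complexBetti S (2 * 1),
      (∀ d ∈ algebraicClasses S 1, cupProduct h4 a d = 0) → σ₁ (η (t a)) = thetaC θ (σ₁ (η a)) := by
    intro a ha
    have hga := LinearMap.congr_fun hgcomm (σ (η a))
    simp only [LinearMap.comp_apply] at hga
    rw [hσ₁def, LinearMap.comp_apply, LinearMap.comp_apply, hconj a ha, hga]
  have heigσ₁ : thetaC θ (σ₁ x) = (e : ℂ) • σ₁ x := by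
    have hgx := LinearMap.congr_fun hgcomm (σ x)
    simp only [LinearMap.comp_apply] at hgx
    rw [hσ₁def, LinearMap.comp_apply, ← hgx, heig, map_smul]
  have heig₁ : thetaC θ (c • σ₁ x) = (e : ℂ) • (c • σ₁ x) := by
    rw [map_smul, heigσ₁, smul_comm]
  -- (d) the displayed input: a marked projective K3 surface AT the period `c • σ₁ x ∈ U` with the cycle
  have hPσ₁ := periodPt_ratIsometry σ₁ hσ₁ hσ₁rat hPer
  have hcσ₁U : c • σ₁ x ∈ U := by rw [hσ₁def, LinearMap.comp_apply]; exact hgU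
  have hcc : k3Form (c • σ₁ x) (c • σ₁ x) = 0 := by
    rw [k3Form_smul_left, k3Form_smul_right, hPσ₁.1, mul_zero, mul_zero]
  have hx'pos : 0 < (k3Form (star (c • σ₁ x)) (c • σ₁ x)).re := by
    have hcc' : star c * c = ((‖c‖ ^ 2 : ℝ) : ℂ) := by
      rw [Complex.star_def, Complex.conj_mul', Complex.ofReal_pow]
    rw [star_smul, k3Form_smul_left, k3Form_smul_right, ← mul_assoc, hcc', Complex.re_ofReal_mul]
    exact mul_pos (pow_pos (norm_pos_iff.2 hc0) 2) hPσ₁.2.1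
  obtain ⟨S', hS', η', p', hM'', γ', hγ'alg, hγ'⟩ := hcyc (c • σ₁ x) hcσ₁U heig₁ hcc hx'pos
  obtain ⟨hp'0, ⟨hp'int, hp'gen, hη'int, hη'cup, h20', hline'⟩, hPer'⟩ := hM''
  -- (e) Buskin for `ψ = η'⁻¹ σ₁ η` and `φ = η⁻¹ σ₁⁻¹ η'`
  obtain ⟨σ₁', hσσ₁', hσ₁'σ, hσ₁', hσ₁'rat⟩ := exists_inverse_ratIsometry σ₁ hσ₁ hσ₁rat
  have hμ : complexOrientationFamily.HasPoincareDuality := OrientationFamily.hasPoincareDuality _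
  have hσ1 : ∀ a b, k3Form (σ₁ a) (σ₁ b) = 1 * k3Form a b := fun a b => by rw [hσ₁, one_mul]
  have hσ'1 : ∀ a b, k3Form (σ₁' a) (σ₁' b) = 1 * k3Form a b := fun a b => by rw [hσ₁', one_mul]
  obtain ⟨γψ, hγψ, hψeq⟩ := hB complexOrientationFamily hμ S' S hS' hS p' p ⟨hp'int, hp'gen⟩ ⟨hpint, hpgen⟩
    (η'.symm.toLinearMap ∘ₗ σ₁ ∘ₗ η.toLinearMap)
    (fun y hy => by
      simp only [LinearMap.comp_apply, LinearEquiv.coe_coe]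
      exact isRationalClass_markingConj η' η σ₁ hS' hS hη'int hηint hσ₁rat hy)
    (fun i j y hy => by
      simp only [LinearMap.comp_apply, LinearEquiv.coe_coe]
      exact isOfHodgeType_markingConj η' p' (c • σ₁ x) η p x σ₁ hHT hS' hS hη'int hη'cup h20' hx'pos hηint
        hηcup hp0 h20 hxpos hσ₁rat one_ne_zero hσ1 ⟨c⁻¹, by rw [smul_smul, inv_mul_cancel₀ hc0, one_smul]⟩
        i j y hy)
    (fun a b d hd => by
      simp only [LinearMap.comp_apply, LinearEquiv.coe_coe]
      have h1 := cupProduct_markingConj η' p' η p σ₁ hp0 hη'cup hηcup hσ1 a b d hd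
      rwa [one_mul] at h1)
  obtain ⟨γφ, hγφ, hφeq⟩ := hB complexOrientationFamily hμ S S' hS hS' p p' ⟨hpint, hpgen⟩ ⟨hp'int, hp'gen⟩
    (η.symm.toLinearMap ∘ₗ σ₁' ∘ₗ η'.toLinearMap)
    (fun y hy => by
      simp only [LinearMap.comp_apply, LinearEquiv.coe_coe]
      exact isRationalClass_markingConj η η' σ₁' hS hS' hηint hη'int hσ₁'rat hy)
    (fun i j y hy => by
      simp only [LinearMap.comp_apply, LinearEquiv.coe_coe]
      exact isOfHodgeType_markingConj η p x η' p' (c • σ₁ x) σ₁' hHT hS hS' hηint hηcup h20 hxpos hη'int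
        hη'cup hp'0 h20' hx'pos hσ₁'rat one_ne_zero hσ'1 ⟨c, by rw [map_smul, hσ₁'σ]⟩ i j y hy)
    (fun a b d hd => by
      simp only [LinearMap.comp_apply, LinearEquiv.coe_coe]
      have h1 := cupProduct_markingConj η p η' p' σ₁' hp'0 hηcup hη'cup hσ'1 a b d hd
      rwa [one_mul] at h1)
  -- (f) compose the three correspondences: `Θ = φ ∘ [γ']_* ∘ ψ` is cycle-induced on `S`
  have hCUP := SquareOfGenerator.cupProduct_mem_algebraicClasses_tripleProduct
  obtain ⟨γ₁, hγ₁, hγ₁eq⟩ := corrComp_K3_of_cup complexOrientationFamily hCUP S' S' S hS' hS' hS γ' hγ'alg γψ hγψ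
  obtain ⟨γ₂, hγ₂, hγ₂eq⟩ := corrComp_K3_of_cup complexOrientationFamily hCUP S S' S hS hS' hS γφ hγφ γ₁ hγ₁
  set R : Module.End ℂ (K3Index → ℂ) := σ₁' ∘ₗ thetaC θ ∘ₗ σ₁ with hRdef
  set Θ : complexBetti S (2 * 1) →ₗ[ℂ] complexBetti S (2 * 1) :=
    η.symm.toLinearMap ∘ₗ R ∘ₗ η.toLinearMap with hΘdef
  have hRapply : ∀ v, R v = σ₁' (thetaC θ (σ₁ v)) := fun v => by
    simp only [hRdef, LinearMap.comp_apply]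
  have hΘapply : ∀ y, Θ y = η.symm (σ₁' (thetaC θ (σ₁ (η y)))) := fun y => by
    simp only [hΘdef, hRdef, LinearMap.comp_apply, LinearEquiv.coe_coe]
  have hΘcorr : ∀ y, Θ y = Corr[hS2 ; γ₂, y] := by
    intro y
    have key : Θ y = (η.symm.toLinearMap ∘ₗ σ₁' ∘ₗ η'.toLinearMap)
        ((η'.symm.toLinearMap ∘ₗ (thetaC θ ∘ₗ η'.toLinearMap))
          ((η'.symm.toLinearMap ∘ₗ σ₁ ∘ₗ η.toLinearMap) y)) := by
      simp only [hΘapply, LinearMap.comp_apply, LinearEquiv.coe_coe, LinearEquiv.apply_symm_apply]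
    rw [key, hφeq, hγ', hψeq, ← hγ₁eq, ← hγ₂eq]
  -- (g) `Θ = t` on the transcendental classes
  have hΘT : ∀ y : complexBetti S (2 * 1), (∀ d ∈ algebraicClasses S 1, cupProduct h4 y d = 0) →
      Θ y = t y := by
    intro y hy
    rw [hΘapply, ← hconj₁ y hy, hσ₁'σ, LinearEquiv.symm_apply_apply]
  -- (h) `Θ` maps rational algebraic classes to algebraic classes (rational and of type `(1,1)`)
  have hRrat : ∀ v : K3Index → ℤ, ∃ w : K3Index → ℚ, R (fun i => (v i : ℂ)) = fun i => (w i : ℂ) := by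
    intro v
    obtain ⟨w₁, hw₁⟩ := hσ₁rat v
    obtain ⟨w₂, hw₂⟩ := ratEnd_ratCast σ₁' hσ₁'rat (θ.mulVec w₁)
    refine ⟨w₂, ?_⟩
    rw [hRdef, LinearMap.comp_apply, LinearMap.comp_apply, hw₁, thetaC_ratCast, hw₂]
  have hΘalg : ∀ d ∈ algebraicClasses S 1, IsRationalClass d → Θ d ∈ algebraicClasses S 1 := by
    intro d hd hdQ
    have hrat : IsRationalClass (Θ d) := by
      rw [hΘapply]
      exact isRationalClass_markingConj η η R hS hS hηint hηint hRrat hdQ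
    -- `(R (η d) . x) = e (η d . x) = 0`
    have hRx : k3Form (R (η d)) x = 0 := by
      have h1 : k3Form (σ₁' (thetaC θ (σ₁ (η d)))) x =
          k3Form (σ₁ (σ₁' (thetaC θ (σ₁ (η d))))) (σ₁ x) := (hσ₁ _ _).symm
      rw [hRdef, LinearMap.comp_apply, LinearMap.comp_apply, h1, hσσ₁', hθsa, heigσ₁, k3Form_smul_right,
        hσ₁, hNx d hd, mul_zero]
    -- `R (η d)` is real
    obtain ⟨w, hw'⟩ := (isRationalClass_iff_of_marking hS η hηint d).1 hdQ
    obtain ⟨w', hw''⟩ := ratEnd_ratCast R hRrat w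
    have hreal : star (R (η d)) = R (η d) := by
      rw [hw', hw'']
      funext i
      simp only [Pi.star_apply, Complex.star_def, map_ratCast]
    have hRx' : k3Form (R (η d)) (star x) = 0 := by
      have h := congrArg star hRx
      rwa [star_k3Form, hreal, star_zero] at h
    have h11 : IsOfHodgeType 2 S (2 * 1) 1 1 (Θ d) := by
      obtain ⟨-, -, h3⟩ := hHT S hS (η.symm x) h20 hx0
      refine (h3 _).2 ⟨?_, ?_⟩
      · rw [hΘapply, hηcup, η.apply_symm_apply, η.apply_symm_apply, ← hRapply, hRx, zero_smul]
      · rw [hΘapply, conjClass_marking_symm η hηint, hηcup, η.apply_symm_apply, η.apply_symm_apply,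
          ← hRapply, hRx', zero_smul]
    exact lefschetzOneOne_rational_holds hS2 _ hrat h11
  -- hence `Θ(N¹) ⊆ N¹` (N¹ is spanned by rational algebraic classes)
  obtain ⟨r, d, M, hdQ, hdN, -, hspanN, -, -⟩ := exists_neronSeveri_gramBasis hS2
  have hΘN : ∀ a ∈ algebraicClasses S 1, Θ a ∈ algebraicClasses S 1 := by
    intro a ha
    rw [← hspanN] at ha
    have hle : Submodule.span ℂ (Set.range d) ≤ (algebraicClasses S 1).comap Θ := by
      rw [Submodule.span_le]
      rintro _ ⟨k, rfl⟩
      exact hΘalg (d k) (hdN k) (hdQ k)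
    exact hle ha
  -- (i) NS-absorption: `Θ − t` is Néron–Severi-supported
  obtain ⟨πN, hπN, -, -, hπperp, -, -⟩ := exists_nsProjection_free hS2
  set f : complexBetti S (2 * 1) →ₗ[ℂ] complexBetti S (2 * 1) := Θ - t with hfdef
  have hfT : ∀ y : complexBetti S (2 * 1),
      (∀ d' ∈ algebraicClasses S 1, cupProduct h4 y d' = 0) → f y = 0 := by
    intro y hy
    rw [hfdef, LinearMap.sub_apply, hΘT y hy, sub_self]
  have hfN : ∀ y, f y ∈ algebraicClasses S 1 := by
    intro y
    have hsplit : f y = f (πN y) + f (y - πN y) := by rw [← map_add, add_sub_cancel]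
    rw [hsplit, hfT _ (hπperp y), add_zero, hfdef, LinearMap.sub_apply, ht_N _ (hπN y), sub_zero]
    exact hΘN _ (hπN y)
  obtain ⟨γ, hγ, hγt⟩ := NSAbsorption.exists_corr_of_add_neronSeveriSupported complexOrientationFamily hS2
    t f hfN hfT ⟨γ₂, hγ₂, fun y => by rw [hfdef, LinearMap.sub_apply, add_sub_cancel]; exact hΘcorr y⟩
  -- (j) Varesco's bookkeeping
  exact SquareOfGenerator.squareOfGenerator S hS2 t ht_rat ht_N ⟨γ, hγ, hγt⟩ hgen

end Summit.HodgeConjecture.HodgeConjecture.Theorems.MarkmanPartnerTransport.RMTypeOrbit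

end
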